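import Literature.MathematicalPhysics.QuantumLattice.HeisenbergOrder
import Literature.MathematicalPhysics.QuantumLattice.XYOrderInfraredProofs
import HarnessLib

/-!
# Translation invariance of the ground-state correlations of the Heisenberg model on the torus

Trunk T-QLATTICE; sibling proof file of
`Literature/MathematicalPhysics/QuantumLattice/HeisenbergOrder.lean` (item
`provefact-Literature.MathematicalPhysics.QuantumLattice.groundStateSpinCorrTorus_add_right`),
next to `HeisenbergOrderProofs.lean` (the magnetisation bound). No statement is introduced or
changed here; the file discharges the named fact

* `groundStateSpinCorrTorus_add_right_holds : groundStateSpinCorrTorus_add_right` —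
  `⟨𝐒_{x+v} · 𝐒_{y+v}⟩_{GS,L} = ⟨𝐒_x · 𝐒_y⟩_{GS,L}` for the tracial ground state of the spin-`n/2`
  Heisenberg model `H_L = J Σ_{⟨x,y⟩} 𝐒_x · 𝐒_y` on the discrete torus `(ℤ/Lℤ)^d`.

## Source and proof

Kennedy–Lieb–Shastry [KLS1988JSP] work on "a finite lattice `Λ` with an even number of sites in
every direction and periodic boundary conditions" (p. 1021) and use the translation-averaged form
of the two-point function throughout (the Fourier transform `g_q = ⟨S_{-q} S_q⟩`, p. 1021, and
`⟨S_0 · S_{δᵢ}⟩ = -e₀/d`, eq. (3), p. 1022), i.e. the invariance of the ground-state expectation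
under the translation group of the torus. The invariance itself is the elementary symmetry
argument (Tasaki (2020) §2.1; Bratteli–Robinson II §6.2.1, covariance of the local algebras):

1. the translation `τ_v = (· + v)` is an automorphism of the torus graph (Mathlib
   `SimpleGraph.circulantGraph_adj_translate`; `torusGraph` *is* a circulant graph), so the edge sum
   `Σ_{e ∈ E} 𝐒_x · 𝐒_y` is invariant under the induced relabelling of tensor indices
   `σ ↦ σ ∘ τ_v` (`heisenbergTorus_submatrix_comp_addRight`, a `Finset.sum_nbij'` along `Sym2.map τ_v`
   with the bond covariance `spinBond_submatrix_comp` of `XYOrderInfraredProofs`);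
2. relabelling is conjugation by a permutation unitary commuting with `H_L`, and the tracial
   ground-state functional `O ↦ tr (P₀ O) / tr P₀` is invariant under such conjugations
   (`groundStateFunctional_submatrix_comp` of `XYOrderInfraredProofs`, from
   `Matrix.groundStateFunctional_conj_of_commute` of `FinDimSpectrumProofs`);
3. `S^α_{x+v} S^α_{y+v}` is the relabelling of `S^α_x S^α_y` (`siteSpin_submatrix_comp`).

The junk side `L = 0` holds by definition (`groundStateSpinCorrTorus_zero_side`).

## References

* [KLS1988JSP] = [KennedyLiebShastry1988] T. Kennedy, E. H. Lieb, B. S. Shastry, *Existence of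
  Néel order in some spin-½ Heisenberg antiferromagnets*, J. Stat. Phys. 53 (1988) 1019–1030,
  doi:10.1007/BF01023854, p. 1021 (periodic boundary conditions, `g_q`) and eq. (3), p. 1022.
* H. Tasaki, *Physics and Mathematics of Quantum Many-Body Systems* (Springer, 2020), §2.1.
* O. Bratteli, D. W. Robinson, *Operator Algebras and Quantum Statistical Mechanics II*, §6.2.1.
-/

noncomputable section

open Matrix Finset
open Literature.MathematicalPhysics.QuantumLattice Literature.Probability.LatticeModels

namespace Literature.MathematicalPhysics.QuantumLattice

variable {d : ℕ}

section TorusTranslation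

variable (L : ℕ) [NeZero L]

/-- The edge set of the torus graph is invariant under the translation `x ↦ x + v`
(`torusGraph d L` is Mathlib's circulant graph on `(ℤ/Lℤ)^d`, `SimpleGraph.circulantGraph_adj_translate`).
Kennedy–Lieb–Shastry (1988), p. 1021 ("periodic boundary conditions"). [folklore] -/
theorem sym2Map_addRight_mem_edgeFinset_torusGraph (v : TorusSite d L) (e : Sym2 (TorusSite d L)) :
    Sym2.map (Equiv.addRight v) e ∈ (torusGraph d L).edgeFinset ↔ e ∈ (torusGraph d L).edgeFinset := by
  induction e using Sym2.ind with
  | h x y =>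
    rw [Sym2.map_mk, SimpleGraph.mem_edgeFinset, SimpleGraph.mem_edgeSet,
      SimpleGraph.mem_edgeFinset, SimpleGraph.mem_edgeSet, Equiv.coe_addRight]
    exact SimpleGraph.circulantGraph_adj_translate

/-- **The Heisenberg Hamiltonian of the torus is translation invariant**: relabelling the sites by
`x ↦ x + v` (tensor indices by `σ ↦ σ ∘ (· + v)`) fixes `H_L = J Σ_{⟨x,y⟩} 𝐒_x · 𝐒_y`, since the
translation permutes the bonds of the torus. Dyson–Lieb–Simon (1978) §1; Kennedy–Lieb–Shastry
(1988), p. 1021. [folklore] -/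
theorem heisenbergTorus_submatrix_comp_addRight (n : ℕ) (J : ℝ) (v : TorusSite d L) :
    (heisenbergTorus d L n J).submatrix
        (fun σ : TensorIndex (TorusSite d L) (n + 1) => σ ∘ Equiv.addRight v)
        (fun σ => σ ∘ Equiv.addRight v) =
      heisenbergTorus d L n J := by
  simp only [heisenbergTorus, heisenbergHamiltonian, submatrix_smul, Pi.smul_apply,
    submatrix_finset_sum]
  congr 1
  refine Finset.sum_nbij' (Sym2.map (Equiv.addRight v)) (Sym2.map (Equiv.addRight v).symm)
    (fun e he => ?_) (fun e he => ?_) (fun e _ => ?_) (fun e _ => ?_) (fun e _ => ?_)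
  · exact (sym2Map_addRight_mem_edgeFinset_torusGraph L v e).2 he
  · rw [Equiv.addRight_symm]
    exact (sym2Map_addRight_mem_edgeFinset_torusGraph L (-v) e).2 he
  · simp only [Sym2.map_map, Equiv.symm_comp_self, Sym2.map_id', id_eq]
  · simp only [Sym2.map_map, Equiv.self_comp_symm, Sym2.map_id', id_eq]
  · induction e using Sym2.ind with
    | h x y =>
      simp only [Sym2.map_mk, spinDotSym_mk, spinDot, submatrix_finset_sum,
        spinBond_submatrix_comp]

/-- Translation invariance of the tracial ground state of the Heisenberg model on the torus:
`ω(O ∘ (τ_v × τ_v)) = ω(O)` for the relabelling `τ_v` of tensor indices induced by `x ↦ x + v`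
(a permutation unitary commuting with `H_L`). Tasaki (2020) §2.1. [folklore] -/
theorem groundStateFunctional_heisenbergTorus_submatrix_comp_addRight (n : ℕ) (J : ℝ)
    (v : TorusSite d L) (O : Op (TorusSite d L) (n + 1)) :
    (heisenbergTorus d L n J).groundStateFunctional
        (O.submatrix (fun σ => σ ∘ Equiv.addRight v) (fun σ => σ ∘ Equiv.addRight v)) =
      (heisenbergTorus d L n J).groundStateFunctional O :=
  groundStateFunctional_submatrix_comp (heisenbergHamiltonian_isHermitian n (torusGraph d L) J)
    (Equiv.addRight v) (heisenbergTorus_submatrix_comp_addRight L n J v) O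

end TorusTranslation

/-- **Discharge of `groundStateSpinCorrTorus_add_right`** (translation invariance of the
ground-state correlation on the torus): `⟨𝐒_{x+v} · 𝐒_{y+v}⟩_{GS,L} = ⟨𝐒_x · 𝐒_y⟩_{GS,L}` for all
`L`, `n`, `J`, `v`, `x`, `y`. For `L = 0` both sides are the junk value `0`; for `L ≠ 0`,
`S^α_{x+v} S^α_{y+v}` is the relabelling of `S^α_x S^α_y` along `x ↦ x + v`
(`siteSpin_submatrix_comp`), the relabelling fixes `H_L`
(`heisenbergTorus_submatrix_comp_addRight`), and the tracial ground state is invariant under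
symmetries of `H_L` (`groundStateFunctional_submatrix_comp`). Kennedy–Lieb–Shastry, J. Stat.
Phys. 53 (1988) 1019, p. 1021 (finite lattice with periodic boundary conditions; the two-point
function enters only through its translation average `g_q = ⟨S_{-q} S_q⟩`) and eq. (3), p. 1022
(`⟨S_0 · S_{δᵢ}⟩ = -e₀/d`). [cite: KennedyLiebShastry1988, p. 1021 and eq. (3)] -/
theorem groundStateSpinCorrTorus_add_right_holds :
    groundStateSpinCorrTorus_add_right (d := d) := by
  intro L n J v x y
  rcases Nat.eq_zero_or_pos L with rfl | hL
  · simp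
  · haveI : NeZero L := ⟨hL.ne'⟩
    rw [groundStateSpinCorrTorus_of_neZero, groundStateSpinCorrTorus_of_neZero]
    refine congrArg Complex.re (Finset.sum_congr rfl fun α _ => ?_)
    have hx : siteSpin n (x + v) α =
        (siteSpin n x α : Op (TorusSite d L) (n + 1)).submatrix
          (fun σ => σ ∘ Equiv.addRight v) (fun σ => σ ∘ Equiv.addRight v) :=
      (siteSpin_submatrix_comp n (Equiv.addRight v) x α).symm
    have hy : siteSpin n (y + v) α =
        (siteSpin n y α : Op (TorusSite d L) (n + 1)).submatrix
          (fun σ => σ ∘ Equiv.addRight v) (fun σ => σ ∘ Equiv.addRight v) :=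
      (siteSpin_submatrix_comp n (Equiv.addRight v) y α).symm
    rw [hx, hy, ← Matrix.submatrix_mul _ _ _ _ _ (bijective_comp_equiv (q := n + 1) _),
      groundStateFunctional_heisenbergTorus_submatrix_comp_addRight]

end Literature.MathematicalPhysics.QuantumLattice
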